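import Mathlib.Algebra.Module.Lattice
import Mathlib.LinearAlgebra.Matrix.Basis
import Mathlib.LinearAlgebra.Matrix.ToLin
import Mathlib.LinearAlgebra.Charpoly.ToMatrix
import Mathlib.LinearAlgebra.Matrix.Charpoly.Minpoly
import Mathlib.LinearAlgebra.Matrix.NonsingularInverse
import Mathlib.LinearAlgebra.Basis.Submodule
import Mathlib.LinearAlgebra.Dimension.Free
import HarnessLib

/-!
# The Latimer–MacDuffee–Taussky correspondence for an ARBITRARY endomorphism: `GLₙ(ℤ)`-classes of the
# integer forms of `(V, T)` ↔ classes of the `T`-stable full `ℤ`-lattices of `V` under the automorphisms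
# commuting with `T` (Marseglia 2019 Thm. 8.1, the module-theoretic half of the proof; Marseglia 2025 Thm. 4.1;
# Hertling–Larabi 2026b Thm. 6.2 is the regular case `V = A_g`)

[topic LinearAlgebra/Matrix] Lane `lit-hodgefound` (Track 2 foundations library), seat p15 generation 38, row g38-#1.
Sibling of the tree's `LatimerMacDuffeeRegularMatrices` (Hertling–Larabi Thm. 6.2: REGULAR integer matrices with
characteristic polynomial `g` ↔ `ε`-classes of full `θ`-stable lattices of the cyclic algebra `A_g = ℚ[t]/(g)`) and of
`LatimerMacDuffeeSquarefree` (finiteness for square-free `g`).  THEOREMS ONLY (no definition, no instance, no named fact;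
D-0026 net Literature debt `0`; no `sorry`).

## Sources, VERBATIM

S. Marseglia, *Computing the ideal class monoid of an order*, J. Lond. Math. Soc. 101 (2020) [Marseglia2019], §8
(held `paper:arxiv-1805.09671`, chunks p0014–p0015): «Recall that two `N × N` matrices `A` and `B` with entries in `ℤ`
are conjugate if there exists `O ∈ GL_N(ℤ)` such that `OAO⁻¹ = B`. […] Let `𝓛(R, K)` be the set of full lattices in `K`
which are `R`-modules and pick `I` in `𝓛(R, K)`. Fix a `ℤ`-basis `w̄ = {w₁, …, w_n}` of `I`. The `R`-linear endomorphism
of `I` given by multiplication by `α` can be represented with respect to `w̄` by an integral matrix `A = A(I, w̄)` […].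
Clearly this representation depends on the choice of the `ℤ`-basis of `I`. If we change the `ℤ`-basis of `I` by a
matrix `O ∈ GL_N(ℤ)` then the multiplication by `α` will be represented by `O⁻¹AO`. Hence we have a well defined map
`I → [A]_{∼_ℤ}`. **Theorem 8.1.** The association `Φ : I ↦ [A(I, w̄)]_{∼_ℤ}` induces a bijection
`Φ̃ : 𝓛(R, K)/≃_R → 𝓜_{m,c}(ℤ)/∼_ℤ`. *Proof.* First we prove that the map `Φ̃` is well defined, that is that if
`φ : I → J` is an `R`-linear isomorphism then `Φ(I) = Φ(J)`. Let `w̄` be a `ℤ`-basis of `I` and `φ(w̄)` the induced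
`ℤ`-basis of `J`. Since `φ` is `R`-linear, we have that `A(I, w̄) = A(J, φ(w̄))`, which implies that `Φ(I) = Φ(J)`. We
now prove that `Φ̃` is injective. Let `I` and `J` be in `𝓛(R, K)` and fix the `ℤ`-basis, say `I = w₁ℤ ⊕ … ⊕ w_Nℤ` and
`J = v₁ℤ ⊕ … ⊕ v_Nℤ`. Assume that `Φ(I) = Φ(J)`, that is `A(I, w̄) = O⁻¹A(J, v̄)O` for some `O ∈ GL_N(ℤ)`. By acting with
`O⁻¹` on `v̄` we find a new `ℤ`-basis `v̄′` for `J` such that `A(I, w̄) = A(J, v̄′)`. Now the `ℤ`-linear bijection `I → J`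
defined by `w_i ↦ v′_i` commutes with multiplication by `α`, since the matrices representing the operation with respect
to `w̄` and `v̄′` are the same, and hence it is an `R`-linear isomorphism. Therefore `{I} = {J}` and `Φ̃` is injective.
To conclude we need to prove that `Φ̃` is also surjective. We will do this by explicitly producing a map
`Ψ : 𝓜_{m,c}(ℤ) → 𝓛(R, K)/≃_R` which descends to a retraction `Ψ̃` of `Φ̃`. […] If instead of `A` we take a conjugate
matrix `B`, it will reflect as taking an invertible `ℤ`-linear combination of the eigenvectors […]. Clearly this will
not change the `ℤ`-span that they generate, that is, the lattice `I` […]».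

S. Marseglia, *Modules over orders, conjugacy classes of integral matrices, and abelian varieties over finite fields*,
Res. Number Theory 11 (2025) (ANTS XVI) [Marseglia2025ModulesOverOrders], §4 (held `paper:arxiv-2208.05409`, chunk
p0009): «Pick `M` in `𝓛(R, V)` and choose a `ℤ`-basis `𝓑` of `M`. Define `A_{M,𝓑}` as the matrix that represents
multiplication by `π` on `M` with respect to the basis `𝓑`. Since `M` is an `R`-module, the matrix `A_{M,𝓑}` has
integer entries. Denote by `Ψ` the function that associates the pair `(M, 𝓑)` to the matrix `A_{M,𝓑}`. […]
**Theorem 4.1** [MarICM18]. The function `Ψ` induces a bijection between the isomorphism classes in `𝓛(R, V)` and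
`Mat_{m,h}/∼_ℤ`.»

C. Hertling, K. Larabi, arXiv:2602.15748 (2026) [HertlingLarabi2026b], §6 Thm. 6.2 (the case `V = A_g`, `T = μ_t̄`,
where the automorphisms commuting with `T` are the multiplications by units; the tree's
`LatimerMacDuffeeRegular.exists_equiv_quot_conj_quot_units_smul`).

## What is formalised — the MODULE-THEORETIC HALF of these proofs, for an ARBITRARY pair `(V, T)`

Throughout `V` is a `ℚ`-vector space with `finrank ℚ V = n`, `T : V →ₗ[ℚ] V` ANY endomorphism (no semisimplicity, no
polynomial is fixed).  A `ℚ`-basis `𝔅 = (b_j)` of `V` REPRESENTS an integer matrix `B` when «`T𝔅 = 𝔅·B`», i.e.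
`T b_j = Σ_i B_{ij} b_i` (`toMatrix_eq_map_iff`: iff `B` is the matrix of `T` in `𝔅`); the INTEGER FORMS of `(V,T)` are
the `B ∈ Mₙ(ℤ)` represented by some basis — equivalently (`exists_represents_iff_exists_linearEquiv`) the `B` with
`(ℚⁿ, B) ≅ (V, T)` as `ℚ[x]`-modules.  On the other side stand the `T`-STABLE FULL `ℤ`-LATTICES `L ⊆ V` (Mathlib
`Submodule.IsLattice ℚ L`: finitely generated with `ℚL = V`, and `TL ⊆ L`), modulo the group
`C(T) = {φ ∈ GL_ℚ(V) | φT = Tφ}` — for `V` a module over a commutative `ℚ`-algebra `R = ℚ[α]` acting through `T = α`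
these are exactly Marseglia's `R`-linear isomorphism classes (`exists_centralizer_map_eq_of_equivariant`: an abstract
`T`-equivariant `ℤ`-isomorphism `L ≃ L′` of two such lattices is the restriction of a unique `φ ∈ C(T)`).
* §1 representation ⟺ `LinearMap.toMatrix 𝔅 𝔅 T = B` (`toMatrix_eq_map_iff`); the `ℤ`-span of a basis is a full
  lattice (`isLattice_span_range`), `T`-stable when the basis represents an integer matrix (`mapsTo_span_of_represents`);
  represented matrices have `charpoly B = charpoly T` and `minpoly_ℚ B = minpoly T` (`charpoly_eq_of_represents`,
  `minpoly_map_eq_of_represents`).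
* §2 «Fix a `ℤ`-basis `w̄` of `I` … represented by an integral matrix»: every `T`-stable full lattice has a `ℤ`-basis,
  which is a `ℚ`-basis of `V` representing an INTEGER matrix (`exists_basis_matrix_of_isLattice`).
* §3 «If we change the `ℤ`-basis of `I` by a matrix `O ∈ GL_N(ℤ)` then … `O⁻¹AO`»: two bases spanning the same lattice
  represent `GLₙ(ℤ)`-conjugate matrices (`exists_isUnit_det_mul_eq_mul_of_span_eq`); conversely «by acting with `O⁻¹` on
  `v̄` we find a new `ℤ`-basis» representing the conjugate (`exists_basis_span_eq_represents_of_conj`).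
* §4 «well defined»: `φ ∈ C(T)` carries a representing basis of `L` to one of `φL` representing the SAME matrix
  (`represents_map_of_centralizer`); «injective»: two lattices with bases representing the same matrix differ by some
  `φ ∈ C(T)` (`exists_centralizer_map_eq_of_represents`) — «the `ℤ`-linear bijection `w_i ↦ v′_i` commutes with
  multiplication by `α` … hence it is an `R`-linear isomorphism»; and the equivariant-isomorphism form
  (`exists_centralizer_map_eq_of_equivariant`).
* §5 **THE CORRESPONDENCE** `exists_equiv_quot_conj_quot_centralizer`: a bijection
  `Φ : {integer forms of (V,T)}/GLₙ(ℤ) ≃ {T-stable full lattices}/C(T)` with `Φ [B] = [L]` whenever a `ℤ`-basis of `L`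
  represents `B`; `natCard_quot_conj_eq_natCard_quot_centralizer`.
* §6 the matrix side as printed: `B` is an integer form of `(V,T)` iff `(ℚⁿ, B) ≅ (V, T)`
  (`exists_represents_iff_exists_linearEquiv`), so every integer form has the characteristic and minimal polynomial of
  `T` (`charpoly_eq_of_exists_represents`); for `(V, T) = (A_g, μ_θ)` the integer forms are HL's regular matrices with
  `p_B = g` and `C(T)` the unit group (tree, not restated) and for `T` semisimple with `χ_T = c` they are Marseglia's
  `𝓜_{m,c}(ℤ)` (sequel row g38-#3, via «semisimple + equal characteristic polynomial ⟹ similar», row g38-#2).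

## References
* [Marseglia2019] S. Marseglia, J. Lond. Math. Soc. 101 (2020) 984–1007, §8 Thm. 8.1. [cite: Marseglia2019, §8 Thm. 8.1, pp. 14–15]
* [Marseglia2025ModulesOverOrders] S. Marseglia, Res. Number Theory 11 (2025), §4 Thm. 4.1. [cite: Marseglia2025ModulesOverOrders, §4 Thm. 4.1, chunk p0009]
* [HertlingLarabi2026b] C. Hertling, K. Larabi, arXiv:2602.15748, §6 Thm. 6.2 (LMD33).
* [LatimerMacduffee1933] C. G. Latimer, C. C. MacDuffee, Ann. of Math. 34 (1933) 313–316; [Taussky1949] O. Taussky,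
  Canad. J. Math. 1 (1949) 300–302.
-/

noncomputable section

open scoped Classical
open Polynomial Module Submodule Matrix

namespace Literature.LinearAlgebra.Matrix.LatimerMacDuffeeStableLattices

variable {V : Type*} [AddCommGroup V] [Module ℚ V] {n : ℕ}

/-! ## §1 Bases representing an integer matrix; the lattice of a basis -/

/-- **«`A = A(I, w̄)` represents multiplication by `α` with respect to `w̄`» ⟺ `B` is the matrix of `T` in `𝔅`**:
`T b_j = Σ_i B_{ij} b_i` for all `j` iff `LinearMap.toMatrix 𝔅 𝔅 T = B` (cast to `ℚ`). [cite: Marseglia2019, §8 (before Thm. 8.1), p. 14] -/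
theorem toMatrix_eq_map_iff (b : Basis (Fin n) ℚ V) (T : Module.End ℚ V) (B : Matrix (Fin n) (Fin n) ℤ) :
    LinearMap.toMatrix b b T = B.map (Int.castRingHom ℚ) ↔ ∀ j, T (b j) = ∑ i, (B i j : ℚ) • b i := by
  constructor
  · intro h j
    have h1 : Matrix.toLin b b (LinearMap.toMatrix b b T) (b j) = T (b j) := by rw [Matrix.toLin_toMatrix]
    rw [← h1, h, Matrix.toLin_self]
    simp only [Matrix.map_apply, eq_intCast]
  · intro h
    refine (Matrix.toLin b b).injective ?_
    rw [Matrix.toLin_toMatrix]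
    refine (b.ext fun j => ?_).symm
    rw [Matrix.toLin_self, h j]
    simp only [Matrix.map_apply, eq_intCast]

/-- **The `ℤ`-span of a `ℚ`-basis is a full lattice** (`I = w₁ℤ ⊕ … ⊕ w_Nℤ` with `Iℚ = K`). [cite: Marseglia2019, §8 Thm. 8.1 (proof, «we prove now that `I` is a full lattice»), p. 14] -/
theorem isLattice_span_range (b : Basis (Fin n) ℚ V) : (span ℤ (Set.range b)).IsLattice ℚ where
  fg := Submodule.fg_span (Set.finite_range b)
  span_eq_top := by rw [Submodule.span_span_of_tower, b.span_eq]

/-- **A basis representing an INTEGER matrix spans a `T`-stable lattice** («which implies that `I` is closed under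
multiplication by `α`, and hence it is an `R`-module»). [cite: Marseglia2019, §8 Thm. 8.1 (proof, eq. for `αw_k`), p. 14] -/
theorem mapsTo_span_of_represents {b : Basis (Fin n) ℚ V} {T : Module.End ℚ V} {B : Matrix (Fin n) (Fin n) ℤ}
    (h : ∀ j, T (b j) = ∑ i, (B i j : ℚ) • b i) : ∀ x ∈ span ℤ (Set.range b), T x ∈ span ℤ (Set.range b) := by
  intro x hx
  refine Submodule.span_induction (p := fun x _ => T x ∈ span ℤ (Set.range b)) ?_ (by simp)
    (fun x y _ _ hx hy => by rw [map_add]; exact add_mem hx hy)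
    (fun z x _ hx => by rw [map_zsmul]; exact smul_mem _ _ hx) hx
  rintro _ ⟨j, rfl⟩
  rw [h j]
  exact sum_mem fun i _ => by
    rw [Int.cast_smul_eq_zsmul]
    exact smul_mem _ _ (subset_span ⟨i, rfl⟩)

/-- A represented matrix, cast to `ℚ`, is the matrix of `T`: hence **`charpoly B = charpoly T`**. [cite: Marseglia2019, §8 («then `A` and `B` have the same minimal polynomial `m` and the same characteristic polynomial `c`»), p. 14] -/
theorem charpoly_eq_of_represents [FiniteDimensional ℚ V] {b : Basis (Fin n) ℚ V} {T : Module.End ℚ V}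
    {B : Matrix (Fin n) (Fin n) ℤ} (h : ∀ j, T (b j) = ∑ i, (B i j : ℚ) • b i) :
    B.charpoly.map (Int.castRingHom ℚ) = T.charpoly := by
  rw [← Matrix.charpoly_map, ← (toMatrix_eq_map_iff b T B).2 h, LinearMap.charpoly_toMatrix]

/-- … and **`minpoly_ℚ B = minpoly_ℚ T`**. [cite: Marseglia2019, §8 (first paragraph), p. 14] -/
theorem minpoly_map_eq_of_represents {b : Basis (Fin n) ℚ V} {T : Module.End ℚ V} {B : Matrix (Fin n) (Fin n) ℤ}
    (h : ∀ j, T (b j) = ∑ i, (B i j : ℚ) • b i) : minpoly ℚ (B.map (Int.castRingHom ℚ)) = minpoly ℚ T := by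
  rw [← (toMatrix_eq_map_iff b T B).2 h, LinearMap.minpoly_toMatrix]

/-! ## §2 From a `T`-stable full lattice to a basis and an integer matrix -/

/-- A full lattice is free over `ℤ` of rank `n = dim_ℚ V` («Fix a `ℤ`-basis `w̄ = {w₁, …, w_n}` of `I`»): a
`ℤ`-basis indexed by `Fin n`. [cite: Marseglia2019, §8 (before Thm. 8.1), p. 14] -/
theorem exists_basis_of_isLattice (hn : finrank ℚ V = n) {L : Submodule ℤ V} (hL : L.IsLattice ℚ) :
    ∃ b : Basis (Fin n) ℚ V, span ℤ (Set.range b) = L := by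
  haveI := hL
  have hrank : finrank ℤ L = n := by
    rw [← hn]
    change Cardinal.toNat (Module.rank ℤ L) = Cardinal.toNat (Module.rank ℚ V)
    rw [Submodule.IsLattice.rank' ℚ L]
  let c : Basis (Fin n) ℤ L := Module.finBasisOfFinrankEq ℤ L hrank
  refine ⟨c.extendOfIsLattice ℚ, ?_⟩
  have hr : Set.range (c.extendOfIsLattice ℚ) = L.subtype '' Set.range c := by
    ext x
    simp only [Set.mem_range, Set.mem_image, Basis.extendOfIsLattice_apply, Submodule.coe_subtype,
      exists_exists_eq_and]
  rw [hr, Submodule.span_image, c.span_eq, Submodule.map_subtype_top]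

/-- Coordinates in a basis of elements of its `ℤ`-span are integers. [folklore] -/
private theorem exists_int_eq_repr {b : Basis (Fin n) ℚ V} {x : V} (hx : x ∈ span ℤ (Set.range b)) (i : Fin n) :
    ∃ z : ℤ, (z : ℚ) = b.repr x i := by
  obtain ⟨z, hz⟩ := (b.mem_span_iff_repr_mem ℤ x).1 hx i
  exact ⟨z, by rw [← hz]; rfl⟩

/-- **LATTICE ↦ MATRIX** («The `R`-linear endomorphism of `I` given by multiplication by `α` can be represented with
respect to `w̄` by an integral matrix `A = A(I, w̄)`»; ANTS XVI: «Since `M` is an `R`-module, the matrix `A_{M,𝓑}` has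
integer entries»): a `T`-stable full lattice `L` has a `ℤ`-basis, and any such basis is a `ℚ`-basis of `V` representing
an INTEGER matrix. [cite: Marseglia2019, §8 (before Thm. 8.1), p. 14] [cite: Marseglia2025ModulesOverOrders, §4 (before Thm. 4.1), chunk p0009] -/
theorem exists_matrix_of_span_eq {b : Basis (Fin n) ℚ V} {L : Submodule ℤ V} (hb : span ℤ (Set.range b) = L)
    {T : Module.End ℚ V} (hT : ∀ x ∈ L, T x ∈ L) :
    ∃ B : Matrix (Fin n) (Fin n) ℤ, ∀ j, T (b j) = ∑ i, (B i j : ℚ) • b i := by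
  have hmem : ∀ j, T (b j) ∈ span ℤ (Set.range b) := fun j => by
    rw [hb]; exact hT _ (hb ▸ subset_span ⟨j, rfl⟩)
  have hz : ∀ j i, ∃ z : ℤ, (z : ℚ) = b.repr (T (b j)) i := fun j i => exists_int_eq_repr (hmem j) i
  choose B hB using hz
  refine ⟨Matrix.of fun i j => B j i, fun j => ?_⟩
  conv_lhs => rw [← b.sum_repr (T (b j))]
  exact Finset.sum_congr rfl fun i _ => by rw [Matrix.of_apply, hB]

/-- The two steps together: every `T`-stable full lattice is the `ℤ`-span of a basis of `V` representing an integer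
matrix. [cite: Marseglia2019, §8 (before Thm. 8.1), p. 14] -/
theorem exists_basis_matrix_of_isLattice (hn : finrank ℚ V = n) {L : Submodule ℤ V} (hL : L.IsLattice ℚ)
    {T : Module.End ℚ V} (hT : ∀ x ∈ L, T x ∈ L) :
    ∃ (b : Basis (Fin n) ℚ V) (B : Matrix (Fin n) (Fin n) ℤ),
      span ℤ (Set.range b) = L ∧ ∀ j, T (b j) = ∑ i, (B i j : ℚ) • b i := by
  obtain ⟨b, hb⟩ := exists_basis_of_isLattice hn hL
  obtain ⟨B, hB⟩ := exists_matrix_of_span_eq hb hT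
  exact ⟨b, B, hb, hB⟩

/-! ## §3 Change of `ℤ`-basis ⟷ `GLₙ(ℤ)`-conjugation -/

/-- **The integer change-of-basis matrix** between two bases, the second inside the `ℤ`-span of the first:
«Write `𝔅₂ = 𝔅₁·C` for some matrix `C`» — here `C = P ∈ Mₙ(ℤ)`, `b' j = Σ_i P_{ij} b_i`.
[cite: HertlingLarabi2026b, §6 Thm. 6.2 (proof, «Write `𝔅₂ = 𝔅₁·C`»), chunk p0013] -/
theorem exists_int_toMatrix_of_span_le {b b' : Basis (Fin n) ℚ V}
    (h : span ℤ (Set.range b') ≤ span ℤ (Set.range b)) :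
    ∃ P : Matrix (Fin n) (Fin n) ℤ, P.map (Int.castRingHom ℚ) = b.toMatrix b' := by
  have hz : ∀ j i, ∃ z : ℤ, (z : ℚ) = b.repr (b' j) i := fun j i =>
    exists_int_eq_repr (h (subset_span ⟨j, rfl⟩)) i
  choose P hP using hz
  refine ⟨Matrix.of fun i j => P j i, ?_⟩
  ext i j
  rw [Matrix.map_apply, Matrix.of_apply, eq_intCast, hP, Basis.toMatrix_apply]

/-- **«If we change the `ℤ`-basis of `I` by a matrix `O ∈ GL_N(ℤ)` then the multiplication by `α` will be represented
by `O⁻¹AO`»**: two bases with the same `ℤ`-span representing `B` and `B'` give `GLₙ(ℤ)`-CONJUGATE matrices —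
`PB' = BP` for the unimodular change-of-basis matrix `P` (`𝔅' = 𝔅·P`). [cite: Marseglia2019, §8 (before Thm. 8.1), p. 14] [cite: HertlingLarabi2026b, §6 Thm. 6.2 (proof), chunk p0013] -/
theorem exists_isUnit_det_mul_eq_mul_of_span_eq {b b' : Basis (Fin n) ℚ V} {T : Module.End ℚ V}
    {B B' : Matrix (Fin n) (Fin n) ℤ} (hB : ∀ j, T (b j) = ∑ i, (B i j : ℚ) • b i)
    (hB' : ∀ j, T (b' j) = ∑ i, (B' i j : ℚ) • b' i) (h : span ℤ (Set.range b) = span ℤ (Set.range b')) :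
    ∃ P : Matrix (Fin n) (Fin n) ℤ, IsUnit P.det ∧ P * B' = B * P := by
  obtain ⟨P, hP⟩ := exists_int_toMatrix_of_span_le (b := b) (b' := b') h.symm.le
  obtain ⟨Q, hQ⟩ := exists_int_toMatrix_of_span_le (b := b') (b' := b) h.le
  have hinj : Function.Injective fun M : Matrix (Fin n) (Fin n) ℤ => M.map (Int.castRingHom ℚ) :=
    Matrix.map_injective (Int.castRingHom ℚ).injective_int
  have hPQ : P * Q = 1 := hinj <| by
    change (P * Q).map _ = (1 : Matrix (Fin n) (Fin n) ℤ).map _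
    rw [Matrix.map_mul, hP, hQ, Basis.toMatrix_mul_toMatrix_flip, Matrix.map_one _ (map_zero _) (map_one _)]
  have hQP : Q * P = 1 := hinj <| by
    change (Q * P).map _ = (1 : Matrix (Fin n) (Fin n) ℤ).map _
    rw [Matrix.map_mul, hP, hQ, Basis.toMatrix_mul_toMatrix_flip, Matrix.map_one _ (map_zero _) (map_one _)]
  have hTb : LinearMap.toMatrix b b T = B.map (Int.castRingHom ℚ) := (toMatrix_eq_map_iff b T B).2 hB
  have hTb' : LinearMap.toMatrix b' b' T = B'.map (Int.castRingHom ℚ) := (toMatrix_eq_map_iff b' T B').2 hB'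
  -- `P B' Q = B` over `ℚ`, hence over `ℤ`
  have hconj : P * B' * Q = B := hinj <| by
    change (P * B' * Q).map _ = B.map _
    rw [Matrix.map_mul, Matrix.map_mul, hP, hQ, ← hTb, ← hTb',
      basis_toMatrix_mul_linearMap_toMatrix_mul_basis_toMatrix]
  refine ⟨P, Matrix.isUnit_det_of_right_inverse hPQ, ?_⟩
  calc P * B' = P * B' * (Q * P) := by rw [hQP, mul_one]
    _ = P * B' * Q * P := by simp only [mul_assoc]
    _ = B * P := by rw [hconj]

/-- **`ℤ`-conjugacy is symmetric**: «`A` and `B` are `ℤ`-conjugate if there exists a matrix `P` in `GL_r(ℤ)` such that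
`PA = BP`. We will write `A ∼_ℤ B`» — if `PB = B'P` with `P` unimodular then `P⁻¹B' = BP⁻¹`.
[cite: Marseglia2025ModulesOverOrders, §4 (definition of `∼_ℤ`), chunk p0009] [cite: Marseglia2019, §8 («We will write `[A]_∼` for the conjugacy class»), p. 14] -/
theorem conj_symm {m : Type*} [Fintype m] [DecidableEq m] {B B' : Matrix m m ℤ}
    (h : ∃ P : Matrix m m ℤ, IsUnit P.det ∧ P * B = B' * P) :
    ∃ P : Matrix m m ℤ, IsUnit P.det ∧ P * B' = B * P := by
  obtain ⟨P, hP, hPB⟩ := h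
  refine ⟨P⁻¹, by rw [Matrix.det_nonsing_inv]; exact hP.ringInverse, ?_⟩
  have hPQ : P * P⁻¹ = 1 := Matrix.mul_nonsing_inv P hP
  have hQP : P⁻¹ * P = 1 := Matrix.nonsing_inv_mul P hP
  calc P⁻¹ * B' = P⁻¹ * B' * (P * P⁻¹) := by rw [hPQ, mul_one]
    _ = P⁻¹ * (B' * P) * P⁻¹ := by simp only [mul_assoc]
    _ = P⁻¹ * (P * B) * P⁻¹ := by rw [hPB]
    _ = B * P⁻¹ := by rw [← mul_assoc, hQP, one_mul]

/-- **«By acting with `O⁻¹` on `v̄` we find a new `ℤ`-basis `v̄′` for `J` such that `A(I, w̄) = A(J, v̄′)`»**: if `𝔅`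
(spanning `L`) represents `B` and `PB' = BP` with `P` unimodular, then the basis `𝔅·P` spans `L` too and represents
`B'`. [cite: Marseglia2019, §8 Thm. 8.1 (proof, injectivity), p. 14] -/
theorem exists_basis_span_eq_represents_of_conj {b : Basis (Fin n) ℚ V} {T : Module.End ℚ V}
    {B B' : Matrix (Fin n) (Fin n) ℤ} (hB : ∀ j, T (b j) = ∑ i, (B i j : ℚ) • b i)
    {P : Matrix (Fin n) (Fin n) ℤ} (hP : IsUnit P.det) (hPB : P * B' = B * P) :
    ∃ b' : Basis (Fin n) ℚ V, span ℤ (Set.range b') = span ℤ (Set.range b) ∧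
      ∀ j, T (b' j) = ∑ i, (B' i j : ℚ) • b' i := by
  -- the new basis `b' j = Σ_i P_{ij} b_i`
  have hPQ : P * P⁻¹ = 1 := Matrix.mul_nonsing_inv P hP
  have hQP : P⁻¹ * P = 1 := Matrix.nonsing_inv_mul P hP
  let Pq : Matrix (Fin n) (Fin n) ℚ := P.map (Int.castRingHom ℚ)
  let Qq : Matrix (Fin n) (Fin n) ℚ := P⁻¹.map (Int.castRingHom ℚ)
  have hPQq : Pq * Qq = 1 := by
    change P.map _ * P⁻¹.map _ = 1
    rw [← Matrix.map_mul, hPQ, Matrix.map_one _ (map_zero _) (map_one _)]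
  have hQPq : Qq * Pq = 1 := by
    change P⁻¹.map _ * P.map _ = 1
    rw [← Matrix.map_mul, hQP, Matrix.map_one _ (map_zero _) (map_one _)]
  -- the automorphism of `V` with matrix `P` in the basis `b`
  let e : V ≃ₗ[ℚ] V :=
    LinearEquiv.ofLinear (Matrix.toLin b b Pq) (Matrix.toLin b b Qq)
      (by rw [← Matrix.toLin_mul b b b, hPQq, Matrix.toLin_one])
      (by rw [← Matrix.toLin_mul b b b, hQPq, Matrix.toLin_one])
  let b' : Basis (Fin n) ℚ V := b.map e
  have hb' : ∀ j, b' j = ∑ i, (P i j : ℚ) • b i := fun j => by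
    change Matrix.toLin b b Pq (b j) = _
    rw [Matrix.toLin_self]
    simp only [Pq, Matrix.map_apply, eq_intCast]
  have hb : ∀ j, b j = ∑ i, (P⁻¹ i j : ℚ) • b' i := fun j => by
    have h1 : Matrix.toLin b b Pq (Matrix.toLin b b Qq (b j)) = b j := by
      rw [← LinearMap.comp_apply, ← Matrix.toLin_mul b b b, hPQq, Matrix.toLin_one, LinearMap.id_apply]
    rw [← h1, Matrix.toLin_self, map_sum]
    refine Finset.sum_congr rfl fun i _ => ?_
    rw [map_smul]
    simp only [Qq, Matrix.map_apply, eq_intCast]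
    rfl
  refine ⟨b', le_antisymm (span_le.2 ?_) (span_le.2 ?_), fun j => ?_⟩
  · rintro _ ⟨j, rfl⟩
    rw [hb' j]
    exact sum_mem fun i _ => by
      rw [Int.cast_smul_eq_zsmul]; exact smul_mem _ _ (subset_span ⟨i, rfl⟩)
  · rintro _ ⟨j, rfl⟩
    rw [hb j]
    exact sum_mem fun i _ => by
      rw [Int.cast_smul_eq_zsmul]; exact smul_mem _ _ (subset_span ⟨i, rfl⟩)
  · -- `T b'_j = Σ_i P_{ij} T b_i = Σ_{i,k} P_{ij} B_{ki} b_k = Σ_k (BP)_{kj} b_k = Σ_k (PB')_{kj} b_k = Σ_i B'_{ij} b'_i`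
    have lhs : T (b' j) = ∑ k, ((B * P) k j : ℚ) • b k := by
      rw [hb' j, map_sum]
      simp_rw [map_smul, hB, Finset.smul_sum, smul_smul]
      rw [Finset.sum_comm]
      refine Finset.sum_congr rfl fun k _ => ?_
      rw [← Finset.sum_smul, Matrix.mul_apply]
      push_cast
      simp_rw [mul_comm ((P _ j : ℤ) : ℚ)]
    have rhs : ∑ i, (B' i j : ℚ) • b' i = ∑ k, ((P * B') k j : ℚ) • b k := by
      simp_rw [hb', Finset.smul_sum, smul_smul]
      rw [Finset.sum_comm]
      refine Finset.sum_congr rfl fun k _ => ?_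
      rw [← Finset.sum_smul, Matrix.mul_apply]
      push_cast
      simp_rw [mul_comm ((B' _ j : ℤ) : ℚ)]
    rw [lhs, rhs, hPB]

/-! ## §4 Automorphisms commuting with `T` ⟷ equal represented matrices -/

/-- **«well defined»: an automorphism `φ` commuting with `T` carries a basis of `L` representing `B` to a basis of `φL`
representing the SAME `B`** («Since `φ` is `R`-linear, we have that `A(I, w̄) = A(J, φ(w̄))`»).
[cite: Marseglia2019, §8 Thm. 8.1 (proof, well-definedness), p. 14] -/
theorem represents_map_of_centralizer {b : Basis (Fin n) ℚ V} {T : Module.End ℚ V} {B : Matrix (Fin n) (Fin n) ℤ}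
    (hB : ∀ j, T (b j) = ∑ i, (B i j : ℚ) • b i) (φ : V ≃ₗ[ℚ] V)
    (hφ : (φ : V →ₗ[ℚ] V) ∘ₗ T = T ∘ₗ (φ : V →ₗ[ℚ] V)) :
    (∀ j, T (b.map φ j) = ∑ i, (B i j : ℚ) • b.map φ i) ∧
      span ℤ (Set.range (b.map φ)) = (span ℤ (Set.range b)).map ((φ : V →ₗ[ℚ] V).restrictScalars ℤ) := by
  refine ⟨fun j => ?_, ?_⟩
  · have h1 : T (φ (b j)) = φ (T (b j)) := by
      change (T ∘ₗ (φ : V →ₗ[ℚ] V)) (b j) = ((φ : V →ₗ[ℚ] V) ∘ₗ T) (b j)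
      rw [hφ]
    simp only [Basis.map_apply]
    rw [h1, hB, map_sum]
    simp only [map_smul]
  · have hr : Set.range (b.map φ) = ((φ : V →ₗ[ℚ] V).restrictScalars ℤ) '' Set.range b := by
      ext x
      simp only [Set.mem_range, Basis.map_apply, Set.mem_image, exists_exists_eq_and,
        LinearMap.coe_restrictScalars, LinearEquiv.coe_coe]
    rw [hr, Submodule.span_image]

/-- The `ℚ`-automorphism sending one basis to another. [folklore] -/
private theorem exists_linearEquiv_map_basis (b b' : Basis (Fin n) ℚ V) : ∃ φ : V ≃ₗ[ℚ] V, ∀ j, φ (b j) = b' j :=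
  ⟨b.equiv b' (Equiv.refl _), fun j => by simp⟩

/-- **«injective»: two lattices having bases which represent the SAME matrix differ by an automorphism commuting with
`T`** («the `ℤ`-linear bijection `I → J` defined by `w_i ↦ v′_i` commutes with multiplication by `α`, since the matrices
representing the operation with respect to `w̄` and `v̄′` are the same, and hence it is an `R`-linear isomorphism»).
[cite: Marseglia2019, §8 Thm. 8.1 (proof, injectivity), p. 14] [cite: HertlingLarabi2026b, §6 Thm. 6.2 (proof, «BC = CB»), chunk p0013] -/
theorem exists_centralizer_map_eq_of_represents {b b' : Basis (Fin n) ℚ V} {T : Module.End ℚ V}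
    {B : Matrix (Fin n) (Fin n) ℤ} (hB : ∀ j, T (b j) = ∑ i, (B i j : ℚ) • b i)
    (hB' : ∀ j, T (b' j) = ∑ i, (B i j : ℚ) • b' i) :
    ∃ φ : V ≃ₗ[ℚ] V, (φ : V →ₗ[ℚ] V) ∘ₗ T = T ∘ₗ (φ : V →ₗ[ℚ] V) ∧
      (span ℤ (Set.range b)).map ((φ : V →ₗ[ℚ] V).restrictScalars ℤ) = span ℤ (Set.range b') := by
  obtain ⟨φ, hφ⟩ := exists_linearEquiv_map_basis b b'
  have hcomm : (φ : V →ₗ[ℚ] V) ∘ₗ T = T ∘ₗ (φ : V →ₗ[ℚ] V) := by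
    refine b.ext fun j => ?_
    simp only [LinearMap.coe_comp, Function.comp_apply, LinearEquiv.coe_coe]
    rw [hB j, map_sum, hφ j, hB' j]
    simp only [map_smul, hφ]
  refine ⟨φ, hcomm, ?_⟩
  have hbm : b.map φ = b' := Basis.eq_of_apply_eq fun j => by rw [Basis.map_apply, hφ j]
  rw [← (represents_map_of_centralizer hB φ hcomm).2, hbm]

/-- **MARSEGLIA'S `≃_R` = ORBITS UNDER `C(T)`: an abstract `T`-equivariant `ℤ`-linear isomorphism between two
`T`-stable full lattices is the restriction of an automorphism of `V` commuting with `T`** (an `R`-linear isomorphism of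
lattices extends to an `R`-linear automorphism of `K = Iℚ`; here `R`-linear = commuting with `T`).
[cite: Marseglia2019, §8 Thm. 8.1 (proof, well-definedness and injectivity), p. 14] [cite: Marseglia2025ModulesOverOrders, §3 («the morphism `φ` extends uniquely to a `K`-linear endomorphism of `V`»), chunk p0006] -/
theorem exists_centralizer_map_eq_of_equivariant (hn : finrank ℚ V = n) {T : Module.End ℚ V}
    {L L' : Submodule ℤ V} (hL : L.IsLattice ℚ) (hTL : ∀ x ∈ L, T x ∈ L) (hL' : L'.IsLattice ℚ)
    (f : L ≃ₗ[ℤ] L') (hf : ∀ x : L, (f ⟨T x, hTL x x.2⟩ : V) = T (f x : V)) :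
    ∃ φ : V ≃ₗ[ℚ] V, (φ : V →ₗ[ℚ] V) ∘ₗ T = T ∘ₗ (φ : V →ₗ[ℚ] V) ∧
      L.map ((φ : V →ₗ[ℚ] V).restrictScalars ℤ) = L' ∧ ∀ x : L, φ x = f x := by
  haveI := hL
  haveI := hL'
  obtain ⟨b, B, hb, hB⟩ := exists_basis_matrix_of_isLattice hn hL hTL
  -- the `ℤ`-basis `c` of `L` underlying `b`, and its image `f ∘ c`, a `ℤ`-basis of `L'`
  let c : Basis (Fin n) ℤ L := (b.restrictScalars ℤ).map (LinearEquiv.ofEq _ _ hb)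
  have hc : ∀ j, (c j : V) = b j := fun j => by
    change ((LinearEquiv.ofEq _ _ hb) (b.restrictScalars ℤ j) : V) = b j
    rw [LinearEquiv.coe_ofEq_apply, Basis.restrictScalars_apply]
  let c' : Basis (Fin n) ℤ L' := c.map f
  let b' : Basis (Fin n) ℚ V := c'.extendOfIsLattice ℚ
  have hb'c : ∀ j, b' j = (c' j : V) := fun j => Basis.extendOfIsLattice_apply ℚ c' j
  have hb' : ∀ j, b' j = (f (c j) : V) := fun j => by rw [hb'c j]; rfl
  have hspan' : span ℤ (Set.range b') = L' := by
    have hr : Set.range b' = L'.subtype '' Set.range c' := by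
      rw [← Set.range_comp]; exact congrArg Set.range (funext hb'c)
    rw [hr, Submodule.span_image, c'.span_eq, Submodule.map_subtype_top]
  -- `b'` represents the same matrix `B`, because `f` is `T`-equivariant and `ℤ`-linear
  have hTc : ∀ j, (⟨T (c j : V), hTL _ (c j).2⟩ : L) = ∑ i, B i j • c i := fun j => by
    apply Subtype.ext
    show T (c j : V) = ((∑ i, B i j • c i : L) : V)
    rw [Submodule.coe_sum, hc j, hB j]
    exact Finset.sum_congr rfl fun i _ => by rw [Submodule.coe_smul_of_tower, hc i, Int.cast_smul_eq_zsmul]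
  have hB' : ∀ j, T (b' j) = ∑ i, (B i j : ℚ) • b' i := fun j => by
    rw [hb' j, ← hf (c j), hTc j, map_sum, Submodule.coe_sum]
    exact Finset.sum_congr rfl fun i _ => by
      rw [map_zsmul, Submodule.coe_smul_of_tower, hb' i, Int.cast_smul_eq_zsmul]
  obtain ⟨φ, hφ⟩ := exists_linearEquiv_map_basis b b'
  have hcomm : (φ : V →ₗ[ℚ] V) ∘ₗ T = T ∘ₗ (φ : V →ₗ[ℚ] V) := by
    refine b.ext fun j => ?_
    simp only [LinearMap.coe_comp, Function.comp_apply, LinearEquiv.coe_coe]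
    rw [hB j, map_sum, hφ j, hB' j]
    simp only [map_smul, hφ]
  have hbm : b.map φ = b' := Basis.eq_of_apply_eq fun j => by rw [Basis.map_apply, hφ j]
  have hmap : L.map ((φ : V →ₗ[ℚ] V).restrictScalars ℤ) = L' := by
    rw [← hb, ← (represents_map_of_centralizer hB φ hcomm).2, hbm, hspan']
  refine ⟨φ, hcomm, hmap, fun x => ?_⟩
  -- `φ` and `f` agree on the `ℤ`-basis `c`, hence on `L`
  have hagree : ((φ : V →ₗ[ℚ] V).restrictScalars ℤ).domRestrict L = L'.subtype ∘ₗ (f : L →ₗ[ℤ] L') := by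
    refine c.ext fun j => ?_
    simp only [LinearMap.domRestrict_apply, LinearMap.coe_restrictScalars, LinearEquiv.coe_coe,
      LinearMap.coe_comp, Function.comp_apply, Submodule.coe_subtype]
    rw [hc j, hφ j, hb' j]
  have := LinearMap.congr_fun hagree x
  simpa using this

/-! ## §5 THE CORRESPONDENCE -/

/-- **THE LATIMER–MACDUFFEE–TAUSSKY CORRESPONDENCE FOR AN ARBITRARY ENDOMORPHISM (Marseglia 2019 Thm. 8.1 ∕ 2025
Thm. 4.1, module-theoretic half; Hertling–Larabi Thm. 6.2 for `V = A_g`).**  For a `ℚ`-vector space `V` of dimension `n`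
and ANY `T ∈ End_ℚ(V)` there is a bijection `Φ` from the `GLₙ(ℤ)`-conjugacy classes (`PB = B′P`, `P` unimodular) of the
INTEGER FORMS of `(V, T)` — the `B ∈ Mₙ(ℤ)` which are the matrix of `T` in some basis of `V`, i.e. `(ℚⁿ, B) ≅ (V, T)` —
onto the classes of `T`-STABLE FULL `ℤ`-LATTICES `L ⊆ V` modulo the automorphisms `φ` of `V` commuting with `T`
(`L′ = φL`), characterised by `Φ [B] = [L]` whenever a `ℤ`-basis of `L` represents `B` («The association
`Φ : I ↦ [A(I, w̄)]_{∼_ℤ}` induces a bijection `Φ̃ : 𝓛(R,K)/≃_R → 𝓜_{m,c}(ℤ)/∼_ℤ`»; here stated as its inverse).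
[cite: Marseglia2019, §8 Thm. 8.1, pp. 14–15] [cite: Marseglia2025ModulesOverOrders, §4 Thm. 4.1, chunk p0009] [cite: HertlingLarabi2026b, §6 Thm. 6.2, chunks p0012–p0013] -/
theorem exists_equiv_quot_conj_quot_centralizer (hn : finrank ℚ V = n) (T : Module.End ℚ V) :
    ∃ Φ : Quot (fun B B' : {B : Matrix (Fin n) (Fin n) ℤ //
                ∃ b : Basis (Fin n) ℚ V, ∀ j, T (b j) = ∑ i, (B i j : ℚ) • b i} =>
              ∃ P : Matrix (Fin n) (Fin n) ℤ, IsUnit P.det ∧ P * B.1 = B'.1 * P) ≃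
          Quot (fun L L' : {L : Submodule ℤ V // L.IsLattice ℚ ∧ ∀ x ∈ L, T x ∈ L} =>
            ∃ φ : V ≃ₗ[ℚ] V, (φ : V →ₗ[ℚ] V) ∘ₗ T = T ∘ₗ (φ : V →ₗ[ℚ] V) ∧
              L.1.map ((φ : V →ₗ[ℚ] V).restrictScalars ℤ) = L'.1),
      ∀ (B : {B : Matrix (Fin n) (Fin n) ℤ // ∃ b : Basis (Fin n) ℚ V, ∀ j, T (b j) = ∑ i, (B i j : ℚ) • b i})
        (L : {L : Submodule ℤ V // L.IsLattice ℚ ∧ ∀ x ∈ L, T x ∈ L})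
        (b : Basis (Fin n) ℚ V), span ℤ (Set.range b) = L.1 →
          (∀ j, T (b j) = ∑ i, (B.1 i j : ℚ) • b i) → Φ (Quot.mk _ B) = Quot.mk _ L := by
  -- MATRIX ↦ LATTICE: the span of a representing basis
  have hex : ∀ B : {B : Matrix (Fin n) (Fin n) ℤ // ∃ b : Basis (Fin n) ℚ V, ∀ j, T (b j) = ∑ i, (B i j : ℚ) • b i},
      ∃ (L : {L : Submodule ℤ V // L.IsLattice ℚ ∧ ∀ x ∈ L, T x ∈ L}) (b : Basis (Fin n) ℚ V),
        span ℤ (Set.range b) = L.1 ∧ ∀ j, T (b j) = ∑ i, (B.1 i j : ℚ) • b i := fun B => by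
    obtain ⟨b, hb⟩ := B.2
    exact ⟨⟨span ℤ (Set.range b), isLattice_span_range b, mapsTo_span_of_represents hb⟩, b, rfl, hb⟩
  choose Λ β hβ hΛ using hex
  -- LATTICE ↦ MATRIX: the matrix of `T` in a `ℤ`-basis
  have hex' : ∀ L : {L : Submodule ℤ V // L.IsLattice ℚ ∧ ∀ x ∈ L, T x ∈ L},
      ∃ (B : {B : Matrix (Fin n) (Fin n) ℤ // ∃ b : Basis (Fin n) ℚ V, ∀ j, T (b j) = ∑ i, (B i j : ℚ) • b i})
        (b : Basis (Fin n) ℚ V), span ℤ (Set.range b) = L.1 ∧ ∀ j, T (b j) = ∑ i, (B.1 i j : ℚ) • b i := fun L => by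
    obtain ⟨b, B, hb, hB⟩ := exists_basis_matrix_of_isLattice hn L.2.1 L.2.2
    exact ⟨⟨B, b, hB⟩, b, hb, hB⟩
  choose M γ hγ hM using hex'
  let Φ : Quot (fun B B' : {B : Matrix (Fin n) (Fin n) ℤ //
                ∃ b : Basis (Fin n) ℚ V, ∀ j, T (b j) = ∑ i, (B i j : ℚ) • b i} =>
              ∃ P : Matrix (Fin n) (Fin n) ℤ, IsUnit P.det ∧ P * B.1 = B'.1 * P) →
      Quot (fun L L' : {L : Submodule ℤ V // L.IsLattice ℚ ∧ ∀ x ∈ L, T x ∈ L} =>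
        ∃ φ : V ≃ₗ[ℚ] V, (φ : V →ₗ[ℚ] V) ∘ₗ T = T ∘ₗ (φ : V →ₗ[ℚ] V) ∧
          L.1.map ((φ : V →ₗ[ℚ] V).restrictScalars ℤ) = L'.1) :=
    Quot.lift (fun B => Quot.mk _ (Λ B)) fun B B' hBB' => Quot.sound <| by
      -- a basis of `Λ B` representing `B'` (acting with `P` on `β B`), then compare with `β B'`
      obtain ⟨P, hP, hPB⟩ := conj_symm hBB'
      obtain ⟨b₁, hb₁, hB'b₁⟩ := exists_basis_span_eq_represents_of_conj (hΛ B) hP hPB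
      obtain ⟨φ, hφ, hmap⟩ := exists_centralizer_map_eq_of_represents hB'b₁ (hΛ B')
      exact ⟨φ, hφ, by rw [← hβ B, ← hb₁, hmap, hβ B']⟩
  let Ψ : Quot (fun L L' : {L : Submodule ℤ V // L.IsLattice ℚ ∧ ∀ x ∈ L, T x ∈ L} =>
        ∃ φ : V ≃ₗ[ℚ] V, (φ : V →ₗ[ℚ] V) ∘ₗ T = T ∘ₗ (φ : V →ₗ[ℚ] V) ∧
          L.1.map ((φ : V →ₗ[ℚ] V).restrictScalars ℤ) = L'.1) →
      Quot (fun B B' : {B : Matrix (Fin n) (Fin n) ℤ //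
                ∃ b : Basis (Fin n) ℚ V, ∀ j, T (b j) = ∑ i, (B i j : ℚ) • b i} =>
              ∃ P : Matrix (Fin n) (Fin n) ℤ, IsUnit P.det ∧ P * B.1 = B'.1 * P) :=
    Quot.lift (fun L => Quot.mk _ (M L)) fun L L' ⟨φ, hφ, hmap⟩ => Quot.sound <| by
      -- `φ(γ L)` is a basis of `L'` representing `M L`; `γ L'` represents `M L'`; same span ⟹ conjugate
      obtain ⟨hrep, hspan⟩ := represents_map_of_centralizer (hM L) φ hφ
      rw [hγ L, hmap, ← hγ L'] at hspan
      exact conj_symm (exists_isUnit_det_mul_eq_mul_of_span_eq hrep (hM L') hspan)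
  have hΦ : ∀ (B : {B : Matrix (Fin n) (Fin n) ℤ // ∃ b : Basis (Fin n) ℚ V, ∀ j, T (b j) = ∑ i, (B i j : ℚ) • b i})
      (L : {L : Submodule ℤ V // L.IsLattice ℚ ∧ ∀ x ∈ L, T x ∈ L})
      (b : Basis (Fin n) ℚ V), span ℤ (Set.range b) = L.1 →
        (∀ j, T (b j) = ∑ i, (B.1 i j : ℚ) • b i) → Φ (Quot.mk _ B) = Quot.mk _ L := by
    intro B L b hb hrep
    change Quot.mk _ (Λ B) = Quot.mk _ L
    refine Quot.sound ?_
    obtain ⟨φ, hφ, hmap⟩ := exists_centralizer_map_eq_of_represents (hΛ B) hrep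
    exact ⟨φ, hφ, by rw [← hβ B, hmap, hb]⟩
  refine ⟨{ toFun := Φ, invFun := Ψ, left_inv := ?_, right_inv := ?_ }, hΦ⟩
  · rintro ⟨B⟩
    change Quot.mk _ (M (Λ B)) = Quot.mk _ B
    refine Quot.sound ?_
    -- `γ (Λ B)` and `β B` are two bases of `Λ B`, representing `M (Λ B)` and `B`
    exact exists_isUnit_det_mul_eq_mul_of_span_eq (hΛ B) (hM (Λ B)) ((hβ B).trans (hγ (Λ B)).symm)
  · rintro ⟨L⟩
    change Φ (Quot.mk _ (M L)) = Quot.mk _ L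
    exact hΦ (M L) L (γ L) (hγ L) (hM L)

/-- **«bijection»: the two class sets have the same cardinality** (as `Nat.card`; both sides are `0` when infinite).
[cite: Marseglia2019, §8 Thm. 8.1, pp. 14–15] -/
theorem natCard_quot_conj_eq_natCard_quot_centralizer (hn : finrank ℚ V = n) (T : Module.End ℚ V) :
    Nat.card (Quot (fun B B' : {B : Matrix (Fin n) (Fin n) ℤ //
                ∃ b : Basis (Fin n) ℚ V, ∀ j, T (b j) = ∑ i, (B i j : ℚ) • b i} =>
              ∃ P : Matrix (Fin n) (Fin n) ℤ, IsUnit P.det ∧ P * B.1 = B'.1 * P)) =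
      Nat.card (Quot (fun L L' : {L : Submodule ℤ V // L.IsLattice ℚ ∧ ∀ x ∈ L, T x ∈ L} =>
            ∃ φ : V ≃ₗ[ℚ] V, (φ : V →ₗ[ℚ] V) ∘ₗ T = T ∘ₗ (φ : V →ₗ[ℚ] V) ∧
              L.1.map ((φ : V →ₗ[ℚ] V).restrictScalars ℤ) = L'.1)) := by
  obtain ⟨Φ, -⟩ := exists_equiv_quot_conj_quot_centralizer hn T
  exact Nat.card_congr Φ

/-! ## §6 The matrix side as printed: `(ℚⁿ, B) ≅ (V, T)` -/

/-- **`B` is an integer form of `(V, T)` — the matrix of `T` in some basis — iff `(ℚⁿ, B) ≅ (V, T)` as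
`ℚ[x]`-modules**: there is a `ℚ`-linear isomorphism `e : ℚⁿ ≃ V` with `e ∘ B = T ∘ e`. [cite: Marseglia2019, §8 Thm. 8.1 (proof, «`A` represents the `ℚ`-linear map induced by multiplication by `α` on `V = I ⊗_ℤ ℚ`»), p. 14] -/
theorem exists_represents_iff_exists_linearEquiv (T : Module.End ℚ V) (B : Matrix (Fin n) (Fin n) ℤ) :
    (∃ b : Basis (Fin n) ℚ V, ∀ j, T (b j) = ∑ i, (B i j : ℚ) • b i) ↔
      ∃ e : (Fin n → ℚ) ≃ₗ[ℚ] V,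
        (e : (Fin n → ℚ) →ₗ[ℚ] V) ∘ₗ Matrix.toLin' (B.map (Int.castRingHom ℚ)) = T ∘ₗ (e : (Fin n → ℚ) →ₗ[ℚ] V) := by
  constructor
  · rintro ⟨b, hb⟩
    refine ⟨b.equivFun.symm, ?_⟩
    refine (Pi.basisFun ℚ (Fin n)).ext fun j => ?_
    simp only [LinearMap.coe_comp, Function.comp_apply, LinearEquiv.coe_coe, Pi.basisFun_apply]
    rw [Matrix.toLin'_apply, Matrix.mulVec_single_one, Basis.equivFun_symm_apply, Basis.equivFun_symm_apply]
    simp only [Pi.single_apply, ite_smul, one_smul, zero_smul, Finset.sum_ite_eq', Finset.mem_univ, if_true]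
    rw [hb j]
    exact Finset.sum_congr rfl fun i _ => by rw [Matrix.col_apply, Matrix.map_apply, eq_intCast]
  · rintro ⟨e, he⟩
    refine ⟨(Pi.basisFun ℚ (Fin n)).map e, fun j => ?_⟩
    simp only [Basis.map_apply, Pi.basisFun_apply]
    have h1 := LinearMap.congr_fun he (Pi.single j 1)
    simp only [LinearMap.coe_comp, Function.comp_apply, LinearEquiv.coe_coe] at h1
    rw [← h1, Matrix.toLin'_apply, Matrix.mulVec_single_one]
    have h2 : (B.map (Int.castRingHom ℚ)).col j = ∑ i, (B i j : ℚ) • Pi.single (M := fun _ => ℚ) i 1 := by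
      ext k
      simp only [Matrix.col_apply, Matrix.map_apply, eq_intCast, Finset.sum_apply, Pi.smul_apply,
        Pi.single_apply, smul_eq_mul, mul_ite, mul_one, mul_zero, Finset.sum_ite_eq, Finset.mem_univ, if_true]
    rw [h2, map_sum]
    simp only [map_smul]

/-- Hence **every integer form of `(V, T)` has the characteristic polynomial and the rational minimal polynomial of
`T`** («If this is the case, then `A` and `B` have the same minimal polynomial `m` and the same characteristic
polynomial `c`»). [cite: Marseglia2019, §8 (first paragraph), p. 14] -/
theorem charpoly_eq_of_exists_represents [FiniteDimensional ℚ V] {T : Module.End ℚ V} {B : Matrix (Fin n) (Fin n) ℤ}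
    (h : ∃ b : Basis (Fin n) ℚ V, ∀ j, T (b j) = ∑ i, (B i j : ℚ) • b i) :
    B.charpoly.map (Int.castRingHom ℚ) = T.charpoly ∧ minpoly ℚ (B.map (Int.castRingHom ℚ)) = minpoly ℚ T := by
  obtain ⟨b, hb⟩ := h
  exact ⟨charpoly_eq_of_represents hb, minpoly_map_eq_of_represents hb⟩

/-- Conversely, **two integer forms of the same `(V, T)` are conjugate over `ℚ`** (they are matrices of one
endomorphism in two bases): `GLₙ(ℚ)`-conjugate, though in general NOT `GLₙ(ℤ)`-conjugate — the classes of Theorem 8.1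
refine rational similarity. [cite: Marseglia2019, §8 («The converse is not true in general»), p. 14] -/
theorem exists_rat_conj_of_represents {b b' : Basis (Fin n) ℚ V} {T : Module.End ℚ V}
    {B B' : Matrix (Fin n) (Fin n) ℤ} (hB : ∀ j, T (b j) = ∑ i, (B i j : ℚ) • b i)
    (hB' : ∀ j, T (b' j) = ∑ i, (B' i j : ℚ) • b' i) :
    ∃ P : Matrix (Fin n) (Fin n) ℚ, IsUnit P.det ∧
      P * B'.map (Int.castRingHom ℚ) = B.map (Int.castRingHom ℚ) * P := by
  refine ⟨b.toMatrix b', ?_, ?_⟩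
  · exact Matrix.isUnit_det_of_right_inverse (Basis.toMatrix_mul_toMatrix_flip b b')
  · rw [← (toMatrix_eq_map_iff b T B).2 hB, ← (toMatrix_eq_map_iff b' T B').2 hB']
    have h := basis_toMatrix_mul_linearMap_toMatrix_mul_basis_toMatrix b b' b b' T
    calc b.toMatrix b' * LinearMap.toMatrix b' b' T
        = b.toMatrix b' * LinearMap.toMatrix b' b' T * (b'.toMatrix b * b.toMatrix b') := by
          rw [Basis.toMatrix_mul_toMatrix_flip, mul_one]
      _ = b.toMatrix b' * LinearMap.toMatrix b' b' T * b'.toMatrix b * b.toMatrix b' := by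
          simp only [mul_assoc]
      _ = LinearMap.toMatrix b b T * b.toMatrix b' := by rw [h]

end Literature.LinearAlgebra.Matrix.LatimerMacDuffeeStableLattices
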